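/-
Copyright: derived here (Resolution Observatory cell `pub-rosobs`, carver gen 61). AI-written Lean; AI review is
weaker than expert review.  Companion file of the cell's POLYNOMIAL weighted-centre model `W(f)` (engine 1's `W(f)` /
(P)-system TOY MODEL; THEOREM-F-eng1-g40 §1 (P), REMARK S (1)).  Instrument — NOT a resolution theorem and NOT a
statement about the invariant of [AbramovichTemkinWlodarczyk2024].
-/
import Literature.AlgebraicGeometry.Resolution.WeightedCentreTheoremF
import HarnessLib

/-!
# Bridge: the slot form of (P) implies the class-linear pin condition for the truncation

`WeightedCentreTruncation` states engine 1's condition (P) for a slot `l` as `SlotPinned w l g`: `X_l` occurs in the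
truncation `truncate_{w_l}(Π g)` for EVERY graded automorphism pair `(Π, Π⁻¹)` of the weighted polynomial ring, and proves
REMARK S (1): `SlotPinned ⇔ BottomPinned` (it suffices to test automorphisms preserving the truncated ring, applied to the
truncated face `truncate_{w_l} g = killLight_{w_l ≤ w} g`).  `WeightedCentreClassLinearPin` states the repaired class form
`ClassPinned S P l`: `X_l` occurs in `P∘A` for every invertible CLASS-LINEAR `A` (identity outside the class `S`).

* `IsClassLinear.isGraded_linSubst`, `isGradedAutPair_linSubst`, `IsClassLinear.killLight_linSubst_X`: for the weight class
  `S = {w = w_l}`, a class-linear invertible `A` gives a graded automorphism pair `(∘A, ∘A⁻¹)` preserving the truncated ring.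
* **`classPinned_killLight_of_slotPinned` (the bridge).**  `SlotPinned w l g → ClassPinned {w = w_l} (killLight_{w_l ≤ w} g) l`
  (positive weights).  The converse fails in general (non-block graded automorphisms, cf. the shear witness C446 of
  `WeightedCentreTruncation`), and is not needed.
* **`IsGradedIso.eq_id_of_slotPinned` (THEOREM F★ under engine 1's (P)).**  THEOREM F in LEMMA-XL normal form
  (`WeightedCentreTheoremF`) with its pin hypothesis stated as `SlotPinned w i g` for the `f`-class slots.

References: [AbramovichTemkinWlodarczyk2024, §5.1 (p. 1575), Thm. 5.3.1 (2)–(3) (p. 1578)] (CONTEXT ONLY — the statements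
are engine 1's, for its polynomial model); linear substitutions [Lang2002, Ch. IV §1, Ch. XIII §4].  The formalisation is ours.
-/

namespace Literature.AlgebraicGeometry.Resolution.WeightedBlowup

open MvPolynomial InvariantDirection Truncation

section Bridge

variable {L : Type*} [Field L] {ι : Type*} [Fintype ι] [DecidableEq ι] (w : ι → ℚ)

/-- A class-linear substitution on an equal-weight class is GRADED (bookkeeping). [cite: AbramovichTemkinWlodarczyk2024, §5.1 (p. 1575)] -/
theorem InvariantDirection.IsClassLinear.isGraded_linSubst {S : Finset ι} {A : Matrix ι ι L} (hA : IsClassLinear S A)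
    (hS : ∀ j ∈ S, ∀ k ∈ S, w j = w k) : IsGraded w (linSubst fun j k => A j k) :=
  fun i => hA.isWeightedHomogeneous_linSubst hS (isWeightedHomogeneous_X L w i)

/-- **A class-linear invertible `A` on an equal-weight class gives a graded automorphism pair `(∘A, ∘A⁻¹)`** (ours, bookkeeping).
[cite: Lang2002, Ch. XIII §4] -/
theorem InvariantDirection.IsClassLinear.isGradedAutPair_linSubst {S : Finset ι} {A A' : Matrix ι ι L} (hA : IsClassLinear S A)
    (hAA' : A * A' = 1) (hA'A : A' * A = 1) (hS : ∀ j ∈ S, ∀ k ∈ S, w j = w k) :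
    IsGradedAutPair w (linSubst fun j k => A j k) (linSubst fun j k => A' j k) :=
  ⟨hA.isGraded_linSubst w hS, (hA.of_inverse hAA' hA'A).isGraded_linSubst w hS,
    fun G => by rw [linSubst_linSubst, hA'A, linSubst_one, AlgHom.id_apply],
    fun G => by rw [linSubst_linSubst, hAA', linSubst_one, AlgHom.id_apply]⟩

/-- A class-linear substitution for the weight class of `l` maps every slot of weight `≥ w_l` into the truncated ring
`L[N_{≥ w_l}]` (ours, bookkeeping). [cite: AbramovichTemkinWlodarczyk2024, §5.1 (p. 1575)] -/
theorem InvariantDirection.IsClassLinear.killLight_linSubst_X {S : Finset ι} {A : Matrix ι ι L} (hA : IsClassLinear S A) {l : ι}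
    (hS : ∀ k ∈ S, w k = w l) {i : ι} (hi : w l ≤ w i) :
    killLight (fun j => w l ≤ w j) (linSubst (fun j k => A j k) (X i)) = linSubst (fun j k => A j k) (X i) := by
  rw [linSubst_X, map_sum]
  refine Finset.sum_congr rfl fun k _ => ?_
  rw [map_mul, MvPolynomial.algHom_C, MvPolynomial.algebraMap_eq, killLight_X, heavyX]
  split_ifs with hk
  · rfl
  · have hkS : k ∉ S := fun h => hk (le_of_eq (hS k h).symm)
    have hik : i ≠ k := by
      rintro rfl
      exact hk hi
    rw [hA i k (Or.inr hkS), Matrix.one_apply_ne hik, C_0, zero_mul, zero_mul]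

/-- **THE BRIDGE: engine 1's (P) for slot `l` implies the class-linear pin condition for the truncation at `w_l`** (ours):
`SlotPinned w l g → ClassPinned {w = w_l} (killLight_{w_l ≤ w} g) l` for positive weights — via REMARK S (1)
(`slotPinned_iff_bottomPinned`) applied to the graded automorphism pair of a class-linear invertible `A`.
(derived here; instrument for the toy model's condition (P), NOT a resolution theorem)
[cite: AbramovichTemkinWlodarczyk2024, §5.1 (p. 1575)] -/
theorem Truncation.SlotPinned.classPinned_killLight (hw : ∀ j, 0 < w j) {l : ι} {g : MvPolynomial ι L} (hl : SlotPinned w l g) :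
    ClassPinned (Finset.univ.filter fun j => w j = w l) (killLight (fun j => w l ≤ w j) g) l := by
  intro A A' hAA' hA'A hA
  have hS : ∀ k ∈ Finset.univ.filter (fun j => w j = w l), w k = w l := fun k hk => (Finset.mem_filter.mp hk).2
  have hS2 : ∀ j ∈ Finset.univ.filter (fun j => w j = w l), ∀ k ∈ Finset.univ.filter (fun j => w j = w l), w j = w k :=
    fun j hj k hk => by rw [hS j hj, hS k hk]
  exact (slotPinned_iff_bottomPinned w (hw l) (fun i _ => (hw i).ne') g).mp hl _ _
    (hA.isGradedAutPair_linSubst w hAA' hA'A hS2) fun i hi => hA.killLight_linSubst_X w hS hi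

end Bridge

/-! ## THEOREM F★ under engine 1's (P) -/

section TheoremF

open scoped Polynomial

variable {k : Type*} [Field k] {ι : Type*} [Fintype ι] [DecidableEq ι] (p : ℕ) [Fact p.Prime] [CharP k p]

/-- **THEOREM F★ with the pin hypothesis in engine 1's slot form (P)** (T79; derived here — engine 1's statement for its polynomial
model, NOT a resolution theorem): as `IsGradedIso.eq_id_of_classPinned`, with `SlotPinned w i g` at the `f`-class slots.
[cite: AbramovichTemkinWlodarczyk2024, Thm. 5.3.1 (2)–(3) (p. 1578)] -/
theorem IsGradedIso.eq_id_of_slotPinned (hperf : ∀ x : k, ∃ y : k, y ^ p = x) {w : ι → ℚ} {ρ : ℚ} (hρ : 0 < ρ)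
    (hw : ∀ j, p * ρ ≤ w j) {g : MvPolynomial ι k}
    (hg : MvPolynomial.IsWeightedHomogeneous w g ((p : ℚ) * ((p + 1) * ρ)))
    {Φ : (MvPolynomial ι k)[X] →+* (MvPolynomial ι k)[X]} (hΦ : IsGradedIso w ρ g Φ) (h0 : IsIdModSigma Φ)
    (hV : ∀ j, ((p : ℚ) + 1) * ρ < w j → Φ (Polynomial.C (X j)) = Polynomial.C (X j))
    (hW : ∀ n, w n = p * ρ → pureCoeff Φ n p = 0)
    (hP : ∀ i, w i = (p + 1) * ρ → SlotPinned w i g) : Φ = RingHom.id _ := by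
  have hpq : (0 : ℚ) < p := by exact_mod_cast (Fact.out : p.Prime).pos
  have hw' : ∀ j, 0 < w j := fun j => lt_of_lt_of_le (mul_pos hpq hρ) (hw j)
  refine hΦ.eq_id_of_classPinned p hperf hρ hw hg h0 hV hW fun i hi => ?_
  have h := (hP i hi).classPinned_killLight w hw'
  rw [hi] at h
  exact h

end TheoremF

end Literature.AlgebraicGeometry.Resolution.WeightedBlowup
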